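import Summits.Ventures.PercRepro.C025ProfileRankFourDemDA

/-!
# The rank-4 certificate: (Dem)(d) — a pair on a long line receives its demand (night-3 g8)

NIGHT3-G7-RANK4-CERTIFICATE.md §2(d), in the kernel, in a SIMPLIFIED form (no count of coloops is needed): for a pair
`B` with `j(B) = 2` in a simple matroid of rank `4`, `p = ρ(E∖B) = 4` (F4); with `T := cl B ∖ B` (`t ≥ 2` points) and
`F := E ∖ cl B` (`f ≥ 2` points), the three-sets `B ∪ {y}` (`y ∈ F`) pay `≥ 1` each — so `≥ 4` when `f ≥ 4` — and the
`t·f` four-sets `B ∪ {z, y}` (`z ∈ T`, `y ∈ F`) pay at least `1` in total when `f ∈ {2, 3}`: their complement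
`(T∖z) ∪ (F∖y)` has rank `r` with `2 ≤ r ≤ min(2, t−1) + (f−1)`, so (`t = 2, f = 2`) four sets at `1/4`;
(`t = 2, f = 3`) six at `≥ 1/6`; (`t ≥ 3, f = 2`) `2t ≥ 6` at `≥ 1/6`; (`t ≥ 3, f = 3`) `3t ≥ 9` at `≥ 1/9`. For `f = 2`
the two three-sets pay `3/2` each (`ρ(T ∪ {y'}) = 3`), for `f = 3` the three of them pay `≥ 3`; with the four-sets the
total is `≥ 4 = p` in every case.
-/

open scoped Matroid

namespace PercRepro

open Set Finset ThmH

section DemD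

variable {α : Type} [DecidableEq α] {M : Matroid α} [M.Finite]

/-- **(Dem)(d)**: in a simple matroid of rank `4`, a pair `B` whose line has at least two further points (`j(B) = 2`)
receives at least `ρ(E∖B)` (`= 4`) under `w4n`. -/
theorem dem_w4n_of_jB_eq_two (hR : M.eRank = (4 : ℕ∞)) (hsimple : ∀ T ⊆ M.E, T.encard ≤ 2 → M.Indep T)
    {B : Finset α} (hB : B ∈ Profile.Rq M 2) (hBc : B.card = 2) (hj : jB M B = 2) :
    (crk M B : ℚ) ≤ ∑ S ∈ (Shadow.levelSet M 3).filter (fun S => B ⊆ S), w4n M B S := by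
  classical
  have hp4 : crk M B = 4 := crk_eq_four_of_jB_eq_two hR hsimple hB hj
  have hBmem := hB
  rw [Profile.mem_Rq] at hB
  obtain ⟨hBg, hB2⟩ := hB
  set T := clF M B \ B with hT
  set F := gr M \ clF M B with hF
  have hT2 : 2 ≤ T.card := by
    have hc : (clF M B \ B).card = (clF M B).card - B.card := Finset.card_sdiff_of_subset (subset_clF_self hBg)
    unfold jB at hj
    rw [hT, hc]
    omega
  have hF2 : 2 ≤ F.card := by
    have hFT : gr M \ B = F ∪ T := gr_sdiff_eq_union hBg
    have hTj : M.eRk ((T : Finset α) : Set α) ≤ (2 : ℕ∞) := by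
      have := eRk_clF_sdiff_le_jB hBg hB2
      rw [hj] at this
      exact_mod_cast this
    have hFcard : M.eRk ((F : Finset α) : Set α) ≤ (F.card : ℕ∞) := by
      rw [← Set.encard_coe_eq_coe_finsetCard]; exact M.eRk_le_encard _
    have h4 : M.eRk ((gr M \ B : Finset α) : Set α) = (4 : ℕ∞) := by
      rw [eRk_gr_sdiff_eq_crk, hp4]; rfl
    have : (4 : ℕ∞) ≤ (F.card : ℕ∞) + 2 := by
      rw [← h4, hFT, Finset.coe_union]
      calc M.eRk ((F : Finset α) ∪ (T : Finset α) : Set α) ≤ M.eRk (F : Set α) + M.eRk (T : Set α) :=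
            M.eRk_union_le_eRk_add_eRk _ _
        _ ≤ (F.card : ℕ∞) + 2 := add_le_add hFcard hTj
    have : (4 : ℕ) ≤ F.card + 2 := by exact_mod_cast this
    omega
  have hTF : ∀ z ∈ T, ∀ y ∈ F, y ≠ z := by
    intro z hz y hy h
    rw [h] at hy
    exact (Finset.mem_sdiff.1 hy).2 (Finset.mem_sdiff.1 hz).1
  -- the three-sets
  have hA1 : ∀ y ∈ F, 1 ≤ w4n M B (insert y B) := by
    intro y hy
    rw [w4n_insert_eq_of_jB_eq_two hBg hBc hj hp4 hy]
    split_ifs <;> norm_num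
  have hinjA : Set.InjOn (fun y => insert y B) (F : Set α) := by
    intro y hy y' hy' h
    simp only at h
    rw [Finset.mem_coe] at hy hy'
    have : y ∈ insert y' B := by rw [← h]; exact Finset.mem_insert_self _ _
    rw [Finset.mem_insert] at this
    rcases this with h' | h'
    · exact h'
    · exact absurd h' (mem_F_facts hBg hy).2.2.1
  have hsubA : F.image (fun y => insert y B) ⊆ (Shadow.levelSet M 3).filter (fun S => B ⊆ S) := by
    intro S hS; rw [Finset.mem_image] at hS; obtain ⟨y, hy, rfl⟩ := hS
    exact insert_mem_filter_of_mem_F hBmem hy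
  -- the four-sets
  have hinjD : Set.InjOn (fun q : α × α => insert q.2 (insert q.1 B)) ((T ×ˢ F : Finset (α × α)) : Set (α × α)) := by
    rintro ⟨z, y⟩ hq ⟨z', y'⟩ hq' h
    simp only at h
    rw [Finset.mem_coe, Finset.mem_product] at hq hq'
    obtain ⟨hz, hy⟩ := hq
    obtain ⟨hz', hy'⟩ := hq'
    have hyB : y ∉ B := (mem_F_facts hBg hy).2.2.1
    have hzB : z ∉ B := (Finset.mem_sdiff.1 hz).2
    have h1 : y ∈ insert y' (insert z' B) := by rw [← h]; exact Finset.mem_insert_self _ _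
    rw [Finset.mem_insert, Finset.mem_insert] at h1
    rcases h1 with rfl | rfl | h1
    · have h2 : z ∈ insert y (insert z' B) := by rw [← h]; exact Finset.mem_insert_of_mem (Finset.mem_insert_self _ _)
      rw [Finset.mem_insert, Finset.mem_insert] at h2
      rcases h2 with rfl | rfl | h2
      · exact absurd rfl (hTF z hz z hy)
      · rfl
      · exact absurd h2 hzB
    · exact absurd rfl (hTF y hz' y hy)
    · exact absurd h1 hyB
  have hsubD : (T ×ˢ F).image (fun q : α × α => insert q.2 (insert q.1 B)) ⊆
      (Shadow.levelSet M 3).filter (fun S => B ⊆ S) := by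
    intro S hS; rw [Finset.mem_image] at hS; obtain ⟨⟨z, y⟩, hq, rfl⟩ := hS
    rw [Finset.mem_product] at hq
    exact insert_insert_mem_filter_of_mem_T_F hBmem hq.1 hq.2
  have hdisj : Disjoint (F.image (fun y => insert y B))
      ((T ×ˢ F).image (fun q : α × α => insert q.2 (insert q.1 B))) := by
    rw [Finset.disjoint_left]
    intro S hS1 hS2
    rw [Finset.mem_image] at hS1 hS2
    obtain ⟨y, hy, rfl⟩ := hS1
    obtain ⟨⟨z', y'⟩, hq', hh⟩ := hS2
    rw [Finset.mem_product] at hq'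
    simp only at hh
    have hc1 : (insert y B).card = 3 := by
      rw [Finset.card_insert_of_notMem (mem_F_facts hBg hy).2.2.1, hBc]
    have hc2 : (insert y' (insert z' B)).card = 4 := by
      rw [Finset.card_insert_of_notMem, Finset.card_insert_of_notMem (Finset.mem_sdiff.1 hq'.1).2, hBc]
      rw [Finset.mem_insert, not_or]
      exact ⟨hTF z' hq'.1 y' hq'.2, (mem_F_facts hBg hq'.2).2.2.1⟩
    rw [hh] at hc2
    omega
  have hlow : ∑ y ∈ F, w4n M B (insert y B) +
      ∑ q ∈ T ×ˢ F, w4n M B (insert q.2 (insert q.1 B)) ≤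
      ∑ S ∈ (Shadow.levelSet M 3).filter (fun S => B ⊆ S), w4n M B S := by
    rw [← Finset.sum_image hinjA, ← Finset.sum_image hinjD, ← Finset.sum_union hdisj]
    exact Finset.sum_le_sum_of_subset_of_nonneg (Finset.union_subset hsubA hsubD) (fun S _ _ => w4n_nonneg B S)
  have hAsum : (F.card : ℚ) ≤ ∑ y ∈ F, w4n M B (insert y B) := by
    calc (F.card : ℚ) = ∑ _y ∈ F, (1 : ℚ) := by rw [Finset.sum_const, nsmul_eq_mul, mul_one]
      _ ≤ ∑ y ∈ F, w4n M B (insert y B) := Finset.sum_le_sum hA1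
  have hDnonneg : 0 ≤ ∑ q ∈ T ×ˢ F, w4n M B (insert q.2 (insert q.1 B)) :=
    Finset.sum_nonneg (fun _ _ => w4n_nonneg _ _)
  rw [hp4]
  push_cast
  rcases le_or_gt 4 F.card with hf4 | hf3
  · have : (4 : ℚ) ≤ (F.card : ℚ) := by exact_mod_cast hf4
    linarith
  · -- f ∈ {2, 3}: the four-sets pay at least 1 in total
    have hcardD : ((T ×ˢ F).card : ℚ) = (T.card : ℚ) * (F.card : ℚ) := by
      rw [Finset.card_product]; push_cast; ring
    have hterm : ∀ q ∈ T ×ˢ F,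
        (min 2 (T.card - 1) + (F.card - 1) ≤ 2 → 1 / 4 ≤ w4n M B (insert q.2 (insert q.1 B))) ∧
        (min 2 (T.card - 1) + (F.card - 1) ≤ 3 → 1 / 6 ≤ w4n M B (insert q.2 (insert q.1 B))) ∧
        1 / 9 ≤ w4n M B (insert q.2 (insert q.1 B)) := by
      rintro ⟨z, y⟩ hq
      rw [Finset.mem_product] at hq
      rw [w4n_insert_insert_eq_wr hBg hBc hj hp4 hq.1 hq.2]
      obtain ⟨hr2, hrm⟩ := crk_insert_insert_bounds hsimple hBmem hq.1 hq.2 hT2 hF2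
      exact wr_ge hr2 (crk_le_of_eRank hR _) hrm
    have hDsum : ∀ c : ℚ, (∀ q ∈ T ×ˢ F, c ≤ w4n M B (insert q.2 (insert q.1 B))) →
        ((T ×ˢ F).card : ℚ) * c ≤ ∑ q ∈ T ×ˢ F, w4n M B (insert q.2 (insert q.1 B)) := by
      intro c hc
      rw [← nsmul_eq_mul, ← Finset.sum_const]
      exact Finset.sum_le_sum hc
    have hD : 1 ≤ ∑ q ∈ T ×ˢ F, w4n M B (insert q.2 (insert q.1 B)) := by
      rcases Nat.lt_or_ge T.card 3 with ht2 | ht3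
      · have ht : T.card = 2 := by omega
        rcases Nat.lt_or_ge F.card 3 with hf2 | hf3'
        · -- t = 2, f = 2: four sets at 1/4
          have hf : F.card = 2 := by omega
          have := hDsum (1 / 4) (fun q hq => (hterm q hq).1 (by rw [ht, hf]; decide))
          rw [hcardD, ht, hf] at this
          push_cast at this
          linarith
        · -- t = 2, f = 3: six sets at ≥ 1/6
          have hf : F.card = 3 := by omega
          have := hDsum (1 / 6) (fun q hq => (hterm q hq).2.1 (by rw [ht, hf]; decide))
          rw [hcardD, ht, hf] at this
          push_cast at this
          linarith
      · rcases Nat.lt_or_ge F.card 3 with hf2 | hf3'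
        · -- t ≥ 3, f = 2: 2t ≥ 6 sets at ≥ 1/6
          have hf : F.card = 2 := by omega
          have hm : min 2 (T.card - 1) + (F.card - 1) ≤ 3 := by
            rw [hf, min_eq_left (by omega : 2 ≤ T.card - 1)]
          have := hDsum (1 / 6) (fun q hq => (hterm q hq).2.1 hm)
          rw [hcardD, hf] at this
          have ht3q : (3 : ℚ) ≤ (T.card : ℚ) := by exact_mod_cast ht3
          push_cast at this
          linarith
        · -- t ≥ 3, f = 3: 3t ≥ 9 sets at ≥ 1/9
          have hf : F.card = 3 := by omega
          have := hDsum (1 / 9) (fun q hq => (hterm q hq).2.2)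
          rw [hcardD, hf] at this
          have ht3q : (3 : ℚ) ≤ (T.card : ℚ) := by exact_mod_cast ht3
          push_cast at this
          linarith
    rcases Nat.lt_or_ge F.card 3 with hf2 | hf3'
    · -- f = 2: the two three-sets pay 3/2 each
      have hf : F.card = 2 := by omega
      have hA32 : ∀ y ∈ F, w4n M B (insert y B) = 3 / 2 := by
        intro y hy
        rw [w4n_insert_eq_of_jB_eq_two hBg hBc hj hp4 hy,
          if_pos (crk_insert_eq_three_of_card_F_two hsimple hBmem hj hy hf)]
      have hAeq : ∑ y ∈ F, w4n M B (insert y B) = 3 := by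
        rw [Finset.sum_congr rfl hA32, Finset.sum_const, nsmul_eq_mul, hf]; norm_num
      linarith
    · -- f = 3: the three three-sets pay ≥ 3
      have hf : F.card = 3 := by omega
      rw [hf] at hAsum
      push_cast at hAsum
      linarith

end DemD

end PercRepro
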